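import Summits.CriticalPhenomena.PercolationContinuityZ3.Theorems.PercNearOneGluingNoHeavyLowerTailCILHyperedgeTools
import HarnessLib

/-!
# `NoHeavyLowerTail` (stmt-CriticalPhenomena-4575) — the separated margin of a relay block equals "lightness of i minus lightness of the block"
# in the block-closed relation

Support file (prover `prim-hp-3`, hull-port line; `--supports stmt-CriticalPhenomena-4575`).  No definitions, no named facts, no sorries.
Lemma (L1) of the refined plan for the overtaking bound (run/shared/lean/prim/prim-hp-3/PROOF-OVERTAKING-BOUND.md §7): for a nonempty block
`B ⊆ A` of relays, a vertex `i` and any weight `u`, with `R¹_ω = Reach_ω^B` (reachability closed through `B`):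

  `μ_u(i ↮ B, |π(i)| ≤ j) − μ_u(i ↮ B, 1 ≤ |π(B)| ≤ j) = μ_u{|{z ∈ A : R¹ i z}| ≤ j} − μ_u{|{z ∈ A : ∃ t ∈ B, R¹ t z}| ≤ j}`

(`Hyperedge.sepMargin_eq_closure_sub`): on `{i ↔ B}` the two closure events coincide; off it they are the separated events (`|π(B)| ≥ 1` because a
relay of `B` reaches itself).  This identifies the Step-1 cell `f(T,S)` (…CILSeparatedStarExpansion) with a difference of glued lightnesses, to
which the glue bridges and `HullPort.lightness_margin_glue_ge_max_any` apply.
-/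

noncomputable section

namespace Summit.CriticalPhenomena.PercolationContinuityZ3.Theorems

open MeasureTheory Set Literature.Probability.LatticeModels Literature.Probability.Percolation
open scoped Classical BigOperators

variable {n : ℕ}

namespace Hyperedge

/-- **Separated margin = closure-lightness difference.**  See the file header. [folklore] -/
theorem sepMargin_eq_closure_sub (u : Sym2 (Fin n) → unitInterval) (A B : Finset (Fin n)) (i : Fin n) (j : ℕ)
    (hBA : B ⊆ A) (hB : B.Nonempty) :
    (prodBernoulli u).real {ω : BondConfig (Fin n) | (∀ y ∈ B, ¬ (openGraph ω).Reachable i y) ∧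
        (A.filter fun z => (openGraph ω).Reachable i z).card ≤ j} -
      (prodBernoulli u).real {ω : BondConfig (Fin n) | (∀ y ∈ B, ¬ (openGraph ω).Reachable i y) ∧
        1 ≤ (A.filter fun z => ∃ y ∈ B, (openGraph ω).Reachable y z).card ∧
        (A.filter fun z => ∃ y ∈ B, (openGraph ω).Reachable y z).card ≤ j} =
    (prodBernoulli u).real {ω : BondConfig (Fin n) |
        (A.filter fun z => (openGraph ω).Reachable i z ∨
          ((∃ t ∈ B, (openGraph ω).Reachable i t) ∧ ∃ t ∈ B, (openGraph ω).Reachable t z)).card ≤ j} -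
      (prodBernoulli u).real {ω : BondConfig (Fin n) |
        (A.filter fun z => ∃ s ∈ B, ((openGraph ω).Reachable s z ∨
          ((∃ t ∈ B, (openGraph ω).Reachable s t) ∧ ∃ t ∈ B, (openGraph ω).Reachable t z))).card ≤ j} := by
  set μ := prodBernoulli u with hμ
  set C : Set (BondConfig (Fin n)) := {ω | ∃ y ∈ B, (openGraph ω).Reachable i y} with hC
  set SepL := {ω : BondConfig (Fin n) | (∀ y ∈ B, ¬ (openGraph ω).Reachable i y) ∧
    (A.filter fun z => (openGraph ω).Reachable i z).card ≤ j} with hSepL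
  set SepB := {ω : BondConfig (Fin n) | (∀ y ∈ B, ¬ (openGraph ω).Reachable i y) ∧
    1 ≤ (A.filter fun z => ∃ y ∈ B, (openGraph ω).Reachable y z).card ∧
    (A.filter fun z => ∃ y ∈ B, (openGraph ω).Reachable y z).card ≤ j} with hSepB
  set E1 := {ω : BondConfig (Fin n) |
    (A.filter fun z => (openGraph ω).Reachable i z ∨
      ((∃ t ∈ B, (openGraph ω).Reachable i t) ∧ ∃ t ∈ B, (openGraph ω).Reachable t z)).card ≤ j} with hE1
  set E2 := {ω : BondConfig (Fin n) |
    (A.filter fun z => ∃ s ∈ B, ((openGraph ω).Reachable s z ∨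
      ((∃ t ∈ B, (openGraph ω).Reachable s t) ∧ ∃ t ∈ B, (openGraph ω).Reachable t z))).card ≤ j} with hE2
  have hmeas : ∀ S : Set (BondConfig (Fin n)), MeasurableSet S := fun S => (Set.toFinite S).measurableSet
  -- the block filter is always `{z : B ~ z}`
  have hblock : ∀ ω : BondConfig (Fin n), (A.filter fun z => ∃ s ∈ B, ((openGraph ω).Reachable s z ∨
      ((∃ t ∈ B, (openGraph ω).Reachable s t) ∧ ∃ t ∈ B, (openGraph ω).Reachable t z))) =
      (A.filter fun z => ∃ y ∈ B, (openGraph ω).Reachable y z) := by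
    intro ω
    refine Finset.filter_congr fun z _ => ⟨?_, ?_⟩
    · rintro ⟨s, hs, h | ⟨_, ⟨t, ht, htz⟩⟩⟩
      · exact ⟨s, hs, h⟩
      · exact ⟨t, ht, htz⟩
    · rintro ⟨y, hy, hyz⟩
      exact ⟨y, hy, Or.inl hyz⟩
  -- on C: the filter of `i` is `{z : B ~ z}` as well
  have honC : ∀ ω ∈ C, (A.filter fun z => (openGraph ω).Reachable i z ∨
      ((∃ t ∈ B, (openGraph ω).Reachable i t) ∧ ∃ t ∈ B, (openGraph ω).Reachable t z)) =
      (A.filter fun z => ∃ y ∈ B, (openGraph ω).Reachable y z) := by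
    intro ω hω
    obtain ⟨y₀, hy₀, hiy₀⟩ := hω
    refine Finset.filter_congr fun z _ => ⟨?_, ?_⟩
    · rintro (h | ⟨_, ⟨t, ht, htz⟩⟩)
      · exact ⟨y₀, hy₀, hiy₀.symm.trans h⟩
      · exact ⟨t, ht, htz⟩
    · rintro ⟨y, hy, hyz⟩
      exact Or.inr ⟨⟨y₀, hy₀, hiy₀⟩, ⟨y, hy, hyz⟩⟩
  -- off C: the filter of `i` is the plain one
  have hoffC : ∀ ω : BondConfig (Fin n), ω ∉ C → (A.filter fun z => (openGraph ω).Reachable i z ∨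
      ((∃ t ∈ B, (openGraph ω).Reachable i t) ∧ ∃ t ∈ B, (openGraph ω).Reachable t z)) =
      (A.filter fun z => (openGraph ω).Reachable i z) := by
    intro ω hω
    refine Finset.filter_congr fun z _ => ⟨?_, fun h => Or.inl h⟩
    rintro (h | ⟨hiB, _⟩)
    · exact h
    · exact absurd hiB hω
  -- off C the block meets at least one relay (itself)
  have hone : ∀ ω : BondConfig (Fin n), 1 ≤ (A.filter fun z => ∃ y ∈ B, (openGraph ω).Reachable y z).card := by
    intro ω
    obtain ⟨b, hb⟩ := hB
    exact Finset.card_pos.2 ⟨b, Finset.mem_filter.2 ⟨hBA hb, b, hb, SimpleGraph.Reachable.refl _⟩⟩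
  have hnotC : ∀ ω : BondConfig (Fin n), ω ∉ C ↔ ∀ y ∈ B, ¬ (openGraph ω).Reachable i y := by
    intro ω
    simp only [hC, mem_setOf_eq, not_exists, not_and]
  -- set identities
  have h1C : E1 ∩ C = E2 ∩ C := by
    ext ω
    simp only [mem_inter_iff, hE1, hE2, mem_setOf_eq]
    constructor
    · rintro ⟨h, hω⟩
      rw [honC ω hω] at h
      rw [hblock ω]
      exact ⟨h, hω⟩
    · rintro ⟨h, hω⟩
      rw [hblock ω] at h
      rw [honC ω hω]
      exact ⟨h, hω⟩
  have h1d : E1 \ C = SepL := by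
    ext ω
    simp only [mem_sdiff, hE1, hSepL, mem_setOf_eq]
    constructor
    · rintro ⟨h, hω⟩
      rw [hoffC ω hω] at h
      exact ⟨(hnotC ω).1 hω, h⟩
    · rintro ⟨hsep, h⟩
      have hω : ω ∉ C := (hnotC ω).2 hsep
      rw [hoffC ω hω]
      exact ⟨h, hω⟩
  have h2d : E2 \ C = SepB := by
    ext ω
    simp only [mem_sdiff, hE2, hSepB, mem_setOf_eq]
    constructor
    · rintro ⟨h, hω⟩
      rw [hblock ω] at h
      exact ⟨(hnotC ω).1 hω, hone ω, h⟩
    · rintro ⟨hsep, _, h⟩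
      rw [hblock ω]
      exact ⟨h, (hnotC ω).2 hsep⟩
  have s1 := measureReal_inter_add_sdiff₀ (μ := μ) (s := E1) (hmeas C).nullMeasurableSet
  have s2 := measureReal_inter_add_sdiff₀ (μ := μ) (s := E2) (hmeas C).nullMeasurableSet
  rw [h1C, h1d] at s1
  rw [h2d] at s2
  linarith

end Hyperedge

end Summit.CriticalPhenomena.PercolationContinuityZ3.Theorems
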